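import Mathlib.Analysis.Fourier.AddCircle
import Literature.Analysis.FluidPDE.ElgindiOddExtension
import HarnessLib

/-!
# The sine series of a function on `[0, π/2]` with Dirichlet data: Parseval for the function and
for its derivative ([Elgindi2021] §7.1, proof of Proposition 7.1)

Topic `Literature/Analysis/FluidPDE`. Proof file (everything proved, no definitions, no named
facts) on the proof path of the named fact
`Literature.Analysis.FluidPDE.Elgindi.ElgindiGhoulMasmoudi2021_stabilityCore`
(`ElgindiStabilityDecomposition.lean`). T. M. Elgindi, Ann. of Math. 194 (2021) =
arXiv:1904.04795, §7.1 proof of Proposition 7.1 (p. 19):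

> "Now let's expand the left hand side in a series (recalling the boundary conditions):
> `Ψ(R,θ) = Σ_{n∈ℕ}Ψ_n(R)sin(2nθ)`. In particular, `Σ_{n≥2}(4n² − 6)|Ψ_n(R)|²_{L²_R} ≤ 2|Ψ_1(R)|² + |F||Ψ|`."

The sine series of `φ : [0, π/2] → ℝ` with `φ(0) = φ(π/2) = 0` is the Fourier series (period `π`) of
its odd extension `ψ = oddExt φ` on `(−π/2, π/2]`. With `c_n = fourierCoeffOn ψ n` (`n ∈ ℤ`) this file
proves, for `φ ∈ C¹(ℝ)`: Parseval `Σ_n|c_n|² = (2/π)∫₀^{π/2}φ²` (`hasSum_sq_sineCoeff`), the coefficient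
relation `c_n(ψ') = 2in·c_n(ψ)` (`sineCoeff_deriv`) and Parseval for the derivative
`Σ_n 4n²|c_n|² = (2/π)∫₀^{π/2}φ'²` (`hasSum_sq_sineCoeff_deriv`): the identities behind
"`|∂_θΨ|² = Σ4n²|Ψ_n|²`, `|Ψ|² = Σ|Ψ_n|²`".
-/

noncomputable section

open MeasureTheory Set Real Filter intervalIntegral Complex
open _root_.Topology

namespace Literature.Analysis.FluidPDE

namespace Elgindi

/-- `−π/2 < π/2`. [folklore] -/
theorem neg_half_pi_lt_half_pi : -(π / 2) < π / 2 := by linarith [Real.pi_pos]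

/-! ### Symmetric integrals of the odd extension -/

/-- `∫_{−π/2}^{π/2} ψ² = 2∫₀^{π/2} φ²` for the odd extension `ψ` of `φ` (`φ(0) = 0`, `φ` continuous). [folklore] -/
theorem integral_sq_oddExt {φ : ℝ → ℝ} (h0 : φ 0 = 0) (hψ : Continuous (oddExt φ)) :
    ∫ x in (-(π / 2))..(π / 2), oddExt φ x ^ 2 = 2 * ∫ x in (0 : ℝ)..(π / 2), φ x ^ 2 := by
  have i : ∀ a b : ℝ, IntervalIntegrable (fun x => oddExt φ x ^ 2) volume a b := fun a b =>
    (hψ.pow 2).intervalIntegrable a b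
  rw [← integral_add_adjacent_intervals (i (-(π / 2)) 0) (i 0 (π / 2))]
  have h1 : ∫ x in (-(π / 2))..0, oddExt φ x ^ 2 = ∫ x in (0 : ℝ)..(π / 2), φ x ^ 2 := by
    have := intervalIntegral.integral_comp_neg (fun x => oddExt φ x ^ 2) (a := 0) (b := π / 2)
    simp only [neg_zero] at this
    rw [← this]
    refine intervalIntegral.integral_congr fun x hx => ?_
    rw [Set.uIcc_of_le (by positivity)] at hx
    show oddExt φ (-x) ^ 2 = φ x ^ 2
    rw [oddExt_neg φ h0, neg_sq, oddExt_of_nonneg φ hx.1]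
  have h2 : ∫ x in (0 : ℝ)..(π / 2), oddExt φ x ^ 2 = ∫ x in (0 : ℝ)..(π / 2), φ x ^ 2 := by
    refine intervalIntegral.integral_congr fun x hx => ?_
    rw [Set.uIcc_of_le (by positivity)] at hx
    show oddExt φ x ^ 2 = φ x ^ 2
    rw [oddExt_of_nonneg φ hx.1]
  rw [h1, h2]
  ring

/-- `∫_{−π/2}^{π/2} (ψ')² = 2∫₀^{π/2} (φ')²` (`ψ' = φ'(|·|)` is even). [folklore] -/
theorem integral_sq_deriv_oddExt {φ : ℝ → ℝ} (hφ : ContDiff ℝ 1 φ) (h0 : φ 0 = 0) :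
    ∫ x in (-(π / 2))..(π / 2), deriv (oddExt φ) x ^ 2 = 2 * ∫ x in (0 : ℝ)..(π / 2), deriv φ x ^ 2 := by
  have hdc : Continuous (deriv φ) := hφ.continuous_deriv le_rfl
  have e : (fun x => deriv (oddExt φ) x ^ 2) = fun x => deriv φ |x| ^ 2 := by
    funext x; rw [deriv_oddExt hφ h0]
  rw [e]
  have hc : Continuous fun x => deriv φ |x| ^ 2 := (hdc.comp continuous_abs).pow 2
  have i : ∀ a b : ℝ, IntervalIntegrable (fun x => deriv φ |x| ^ 2) volume a b := fun a b => hc.intervalIntegrable a b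
  rw [← integral_add_adjacent_intervals (i (-(π / 2)) 0) (i 0 (π / 2))]
  have h1 : ∫ x in (-(π / 2))..0, deriv φ |x| ^ 2 = ∫ x in (0 : ℝ)..(π / 2), deriv φ x ^ 2 := by
    have := intervalIntegral.integral_comp_neg (fun x => deriv φ |x| ^ 2) (a := 0) (b := π / 2)
    simp only [neg_zero, abs_neg] at this
    rw [← this]
    refine intervalIntegral.integral_congr fun x hx => ?_
    rw [Set.uIcc_of_le (by positivity)] at hx
    show deriv φ |x| ^ 2 = deriv φ x ^ 2
    rw [abs_of_nonneg hx.1]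
  have h2 : ∫ x in (0 : ℝ)..(π / 2), deriv φ |x| ^ 2 = ∫ x in (0 : ℝ)..(π / 2), deriv φ x ^ 2 := by
    refine intervalIntegral.integral_congr fun x hx => ?_
    rw [Set.uIcc_of_le (by positivity)] at hx
    show deriv φ |x| ^ 2 = deriv φ x ^ 2
    rw [abs_of_nonneg hx.1]
  rw [h1, h2]
  ring

/-! ### Parseval for the sine series -/

/-- A continuous real function is in `L²` of a bounded interval, as a complex function. [folklore] -/
theorem memLp_two_ofReal_of_continuous {g : ℝ → ℝ} (hg : Continuous g) (a b : ℝ) :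
    MemLp (fun x => (g x : ℂ)) 2 (volume.restrict (Ioc a b)) := by
  haveI : IsFiniteMeasure (volume.restrict (Ioc a b)) := isFiniteMeasure_restrict.2 measure_Ioc_lt_top.ne
  obtain ⟨C, hC⟩ := (isCompact_Icc (a := a) (b := b)).exists_bound_of_continuousOn hg.continuousOn
  refine MemLp.of_bound (Complex.continuous_ofReal.comp hg).aestronglyMeasurable (max C 0) ?_
  rw [ae_restrict_iff' measurableSet_Ioc]
  refine Filter.Eventually.of_forall fun x hx => ?_
  rw [Complex.norm_real]
  exact (hC x (Ioc_subset_Icc_self hx)).trans (le_max_left _ _)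

/-- **Parseval for the sine series**: with `c_n` the Fourier coefficients (period `π`) of the odd
extension of `φ` on `(−π/2, π/2]`, `Σ_n|c_n|² = (2/π)∫₀^{π/2}φ²` (`φ` continuous with `φ(0) = 0` and
continuous odd extension). [cite: Elgindi2021, §7.1 proof of Proposition 7.1 (p. 19 of arXiv:1904.04795)] -/
theorem hasSum_sq_sineCoeff {φ : ℝ → ℝ} (h0 : φ 0 = 0) (hψ : Continuous (oddExt φ)) :
    HasSum (fun n : ℤ => ‖fourierCoeffOn neg_half_pi_lt_half_pi (fun x => (oddExt φ x : ℂ)) n‖ ^ 2)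
      (2 / π * ∫ x in (0 : ℝ)..(π / 2), φ x ^ 2) := by
  have h := hasSum_sq_fourierCoeffOn neg_half_pi_lt_half_pi (memLp_two_ofReal_of_continuous hψ _ _)
  have e : (π / 2 - -(π / 2))⁻¹ • ∫ x in (-(π / 2))..(π / 2), ‖(oddExt φ x : ℂ)‖ ^ 2 =
      2 / π * ∫ x in (0 : ℝ)..(π / 2), φ x ^ 2 := by
    have e1 : ∫ x in (-(π / 2))..(π / 2), ‖(oddExt φ x : ℂ)‖ ^ 2 = ∫ x in (-(π / 2))..(π / 2), oddExt φ x ^ 2 := by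
      refine intervalIntegral.integral_congr fun x _ => ?_
      simp only [Complex.norm_real, Real.norm_eq_abs, sq_abs]
    rw [e1, integral_sq_oddExt h0 hψ, smul_eq_mul]
    field_simp
    ring
  rw [e] at h
  exact h

/-! ### The coefficients of the derivative -/

/-- The zeroth coefficient of an odd function vanishes. [folklore] -/
theorem sineCoeff_zero {φ : ℝ → ℝ} (h0 : φ 0 = 0) (hψ : Continuous (oddExt φ)) :
    fourierCoeffOn neg_half_pi_lt_half_pi (fun x => (oddExt φ x : ℂ)) 0 = 0 := by
  rw [fourierCoeffOn_eq_integral]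
  simp only [neg_zero, fourier_zero, one_smul]
  rw [intervalIntegral.integral_ofReal]
  have hodd : ∫ x in (-(π / 2))..(π / 2), oddExt φ x = 0 := by
    have i : ∀ a b : ℝ, IntervalIntegrable (oddExt φ) volume a b := fun a b => hψ.intervalIntegrable a b
    rw [← integral_add_adjacent_intervals (i (-(π / 2)) 0) (i 0 (π / 2))]
    have := intervalIntegral.integral_comp_neg (oddExt φ) (a := 0) (b := π / 2)
    simp only [neg_zero] at this
    rw [← this]
    have e : ∫ x in (0 : ℝ)..(π / 2), oddExt φ (-x) = -∫ x in (0 : ℝ)..(π / 2), oddExt φ x := by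
      rw [← intervalIntegral.integral_neg]
      refine intervalIntegral.integral_congr fun x _ => ?_
      exact oddExt_neg φ h0 x
    rw [e]
    ring
  rw [hodd]
  simp

/-- **`c_n(ψ') = 2in·c_n(ψ)`** for the odd extension `ψ` of `φ ∈ C¹` with `φ(0) = φ(π/2) = 0` (the
periodicity `ψ(π/2) = ψ(−π/2) = 0` kills the boundary term). [cite: Elgindi2021, §7.1 proof of Proposition 7.1 ("|∂_θΨ|² … Σ4n²|Ψ_n|²") (p. 19 of arXiv:1904.04795)] -/
theorem sineCoeff_deriv {φ : ℝ → ℝ} (hφ : ContDiff ℝ 1 φ) (h0 : φ 0 = 0) (h1 : φ (π / 2) = 0) (n : ℤ) :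
    fourierCoeffOn neg_half_pi_lt_half_pi (fun x => ((deriv (oddExt φ) x : ℝ) : ℂ)) n =
      2 * I * n * fourierCoeffOn neg_half_pi_lt_half_pi (fun x => (oddExt φ x : ℂ)) n := by
  have hψ := contDiff_one_oddExt hφ h0
  have hψc := hψ.continuous
  have hdψc : Continuous (deriv (oddExt φ)) := hψ.continuous_deriv le_rfl
  rcases eq_or_ne n 0 with rfl | hn
  · -- both sides vanish: `∫ ψ' = ψ(π/2) − ψ(−π/2) = 0`
    simp only [Int.cast_zero, mul_zero, zero_mul]
    have hI : ∫ x in (-(π / 2))..(π / 2), ((deriv (oddExt φ) x : ℝ) : ℂ) = 0 := by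
      rw [intervalIntegral.integral_ofReal,
        intervalIntegral.integral_deriv_eq_sub (fun x _ => (hasDerivAt_oddExt hφ h0 x).differentiableAt)
          (hdψc.intervalIntegrable _ _)]
      rw [oddExt_of_nonneg φ (by positivity : (0 : ℝ) ≤ π / 2), h1, oddExt_neg φ h0,
        oddExt_of_nonneg φ (by positivity : (0 : ℝ) ≤ π / 2), h1]
      simp
    rw [fourierCoeffOn_eq_integral]
    simp only [neg_zero, fourier_zero, one_smul, hI, smul_zero]
  · have hder : ∀ x ∈ Set.uIcc (-(π / 2)) (π / 2), HasDerivAt (fun x => (oddExt φ x : ℂ))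
        (((deriv (oddExt φ) x : ℝ) : ℂ)) x := fun x _ => (hasDerivAt_oddExt hφ h0 x).ofReal_comp.congr_deriv (by
          rw [deriv_oddExt hφ h0])
    have hint : IntervalIntegrable (fun x => ((deriv (oddExt φ) x : ℝ) : ℂ)) volume (-(π / 2)) (π / 2) :=
      (Complex.continuous_ofReal.comp hdψc).intervalIntegrable _ _
    have h := fourierCoeffOn_of_hasDerivAt neg_half_pi_lt_half_pi hn hder hint
    have hb : (oddExt φ (π / 2) : ℂ) - (oddExt φ (-(π / 2)) : ℂ) = 0 := by
      rw [oddExt_neg φ h0, oddExt_of_nonneg φ (by positivity : (0 : ℝ) ≤ π / 2), h1]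
      simp
    rw [hb, mul_zero, zero_sub] at h
    rw [h]
    have hπ : ((π / 2 : ℝ) : ℂ) - ((-(π / 2) : ℝ) : ℂ) = (π : ℂ) := by push_cast; ring
    rw [hπ]
    have hn' : (n : ℂ) ≠ 0 := Int.cast_ne_zero.2 hn
    have hπ0 : (π : ℂ) ≠ 0 := Complex.ofReal_ne_zero.2 Real.pi_pos.ne'
    have hI : (-2 * (π : ℂ) * I * n) ≠ 0 := by
      refine mul_ne_zero (mul_ne_zero (mul_ne_zero (by norm_num) hπ0) Complex.I_ne_zero) hn'
    have e1 : (2 * I * (n : ℂ) * (1 / (-2 * π * I * n))) = -(π : ℂ)⁻¹ := by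
      field_simp
      try ring
    rw [← mul_assoc, e1]
    field_simp

/-- **Parseval for the derivative of the sine series**: `Σ_n 4n²|c_n|² = (2/π)∫₀^{π/2}(φ')²` for
`φ ∈ C¹` with `φ(0) = φ(π/2) = 0`. [cite: Elgindi2021, §7.1 proof of Proposition 7.1 (p. 19 of arXiv:1904.04795)] -/
theorem hasSum_sq_sineCoeff_deriv {φ : ℝ → ℝ} (hφ : ContDiff ℝ 1 φ) (h0 : φ 0 = 0) (h1 : φ (π / 2) = 0) :
    HasSum (fun n : ℤ => 4 * (n : ℝ) ^ 2 * ‖fourierCoeffOn neg_half_pi_lt_half_pi (fun x => (oddExt φ x : ℂ)) n‖ ^ 2)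
      (2 / π * ∫ x in (0 : ℝ)..(π / 2), deriv φ x ^ 2) := by
  have hψ := contDiff_one_oddExt hφ h0
  have hdψc : Continuous (deriv (oddExt φ)) := hψ.continuous_deriv le_rfl
  have h := hasSum_sq_fourierCoeffOn neg_half_pi_lt_half_pi (memLp_two_ofReal_of_continuous hdψc _ _)
  have eterm : (fun n : ℤ => ‖fourierCoeffOn neg_half_pi_lt_half_pi (fun x => ((deriv (oddExt φ) x : ℝ) : ℂ)) n‖ ^ 2) =
      fun n : ℤ => 4 * (n : ℝ) ^ 2 * ‖fourierCoeffOn neg_half_pi_lt_half_pi (fun x => (oddExt φ x : ℂ)) n‖ ^ 2 := by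
    funext n
    rw [sineCoeff_deriv hφ h0 h1 n, norm_mul, norm_mul, norm_mul, Complex.norm_I, Complex.norm_intCast,
      Complex.norm_ofNat]
    rw [← sq_abs (n : ℝ)]
    ring
  have e : (π / 2 - -(π / 2))⁻¹ • ∫ x in (-(π / 2))..(π / 2), ‖((deriv (oddExt φ) x : ℝ) : ℂ)‖ ^ 2 =
      2 / π * ∫ x in (0 : ℝ)..(π / 2), deriv φ x ^ 2 := by
    have e1 : ∫ x in (-(π / 2))..(π / 2), ‖((deriv (oddExt φ) x : ℝ) : ℂ)‖ ^ 2 =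
        ∫ x in (-(π / 2))..(π / 2), deriv (oddExt φ) x ^ 2 := by
      refine intervalIntegral.integral_congr fun x _ => ?_
      simp only [Complex.norm_real, Real.norm_eq_abs, sq_abs]
    rw [e1, integral_sq_deriv_oddExt hφ h0, smul_eq_mul]
    field_simp
    ring
  rw [eterm, e] at h
  exact h

end Elgindi

end Literature.Analysis.FluidPDE
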